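import Mathlib
import HarnessLib
import Summits.CriticalPhenomena.PercolationContinuityZ3.Theses.PercLowPointHalfSpace
import Summits.CriticalPhenomena.PercolationContinuityZ3.Theorems.PercLowPointHalfSpaceLowPointIdentityShift
import Literature.Probability.Percolation.HalfSpaceFloorDilution
import Literature.Probability.Percolation.BondPercolationSymmetry

/-!
# Pivot translation: stub `stub_pivotTranslation` of line SketchIdeator1 (skeleton floor-russo), crux LowPointBookkeeping

Helper file for the crux skeleton `Cruxes/LowPointBookkeeping/Lines/SketchIdeator1.lean`
(item `stmt-CriticalPhenomena-14713`,
`Summit.CriticalPhenomena.PercolationContinuityZ3.Theses.PercLowPointHalfSpace.LowPointBookkeeping`).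
Proves EXACTLY the registered stub signature `stub_pivotTranslation`; no new definition.

## The statement

Write `ℍ = {x ∈ ℤ³ | 0 ≤ x₀}`, `P_s = floorDilutedPercolation 3 p_c s` (the floor-diluted critical
half-space measure), `a_t = (t+1) e₀ = Pi.single 0 (t+1)` and, for a floor point `x` (`x₀ = 0`), a
vector `e` and a target offset `w`, the *pivotal-pair event*
`A(t,x) = {x ↔_ℍ a_t} ∩ {x + e ↔_ℍ w + a_t} ∩ {x ↮_ℍ x + e}`.
Assuming the invariance of `P_s` under the configuration shifts `ω ↦ ω + z` by floor vectors `z`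
(hypothesis `hshift`, supplied by the neighbouring stub `stub_dilutionToolkit`), the column sum
`Σ_t Σ_{x ∈ ∂ℍ} P_s(A(t,x))` is bounded by `Σ_{v : 1 ≤ v₀} P_s({0 ↔_ℍ v} ∩ {e ↔_ℍ v + w} ∩ {0 ↮_ℍ e})`.

## Proof

1. (`preimage_shift_event`, `measure_shift_event`) For a floor vector `z` the shift `u ↦ u + z`
   fixes `ℍ` (`LowPoint.preimage_add_level`), so by the covariance
   `ω + z ∈ {x + z ↔ y + z in ℍ} ↔ ω ∈ {x ↔ y in ℍ}` (`LowPoint.shift_mem_openConnIn_iff`) the pull-back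
   of the event with all base points shifted by `z` is the unshifted event; `hshift` then gives equality
   of the probabilities (the events are measurable, `measurableSet_openConnIn_of_countable`).
2. (`measure_pivot_event_eq`) With `z = x`: `P_s(A(t,x)) = P_s({0 ↔_ℍ a_t - x} ∩ {e ↔_ℍ (a_t - x) + w} ∩ {0 ↮_ℍ e})`.
3. (`tsum_reindex_le`) The map `(t, x) ↦ v = a_t - x` is injective into `{v | 1 ≤ v₀}` (`v₀ = t + 1`
   recovers `t`, then `x = a_t - v`), so the double sum is a sum over part of the index set of the
   right-hand side (`ENNReal.tsum_prod'`, `ENNReal.tsum_comp_le_tsum_of_injective`).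
-/

noncomputable section

namespace Summit.CriticalPhenomena.PercolationContinuityZ3.Theorems.FloorRusso

open MeasureTheory Filter Topology
open Literature.Probability.Percolation Literature.Probability.LatticeModels
open scoped ENNReal

namespace PivotTranslation

/-- For a floor vector `z` (`z 0 = 0`) the pull-back under the configuration shift `ω ↦ ω + z` of the
pivotal-pair event with all base points shifted by `z` is the unshifted event (the shift fixes `ℍ`). -/
theorem preimage_shift_event (z : Site 3) (hz : z 0 = 0) (a b c d p q : Site 3) :
    (BondConfig.relabel (sym2Equiv (Site.shift z))) ⁻¹'
        (openConnIn {x : Site 3 | 0 ≤ x 0} (a + z) (b + z) ∩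
            openConnIn {x : Site 3 | 0 ≤ x 0} (c + z) (d + z) ∩
          (openConnIn {x : Site 3 | 0 ≤ x 0} (p + z) (q + z))ᶜ) =
      openConnIn {x : Site 3 | 0 ≤ x 0} a b ∩ openConnIn {x : Site 3 | 0 ≤ x 0} c d ∩
        (openConnIn {x : Site 3 | 0 ≤ x 0} p q)ᶜ := by
  have hH : ((fun u : Site 3 => u + z) ⁻¹' {x : Site 3 | 0 ≤ x 0}) = {x : Site 3 | 0 ≤ x 0} := by
    ext u
    simp only [Set.mem_preimage, Set.mem_setOf_eq, Pi.add_apply, hz, add_zero]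
  ext ω
  simp only [Set.mem_preimage, Set.mem_inter_iff, Set.mem_compl_iff,
    LowPoint.shift_mem_openConnIn_iff, hH]

/-- **Horizontal translation invariance of the pivotal-pair probability**: under the shift
invariance `hshift` of `P_s` by floor vectors, shifting all base points by a floor vector `z` does
not change the `P_s`-probability of the event. -/
theorem measure_shift_event (s : unitInterval)
    (hshift : ∀ z : Site 3, z 0 = 0 → ∀ S : Set (BondConfig (Site 3)), MeasurableSet S →
      floorDilutedPercolation 3 (criticalProbI 3) s ((BondConfig.relabel (sym2Equiv (Site.shift z))) ⁻¹' S) =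
        floorDilutedPercolation 3 (criticalProbI 3) s S)
    (z : Site 3) (hz : z 0 = 0) (a b c d p q : Site 3) :
    floorDilutedPercolation 3 (criticalProbI 3) s
        (openConnIn {x : Site 3 | 0 ≤ x 0} a b ∩ openConnIn {x : Site 3 | 0 ≤ x 0} c d ∩
          (openConnIn {x : Site 3 | 0 ≤ x 0} p q)ᶜ) =
      floorDilutedPercolation 3 (criticalProbI 3) s
        (openConnIn {x : Site 3 | 0 ≤ x 0} (a + z) (b + z) ∩
            openConnIn {x : Site 3 | 0 ≤ x 0} (c + z) (d + z) ∩
          (openConnIn {x : Site 3 | 0 ≤ x 0} (p + z) (q + z))ᶜ) := by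
  rw [← preimage_shift_event z hz a b c d p q]
  exact hshift z hz _
    (((measurableSet_openConnIn_of_countable _ _ _).inter
      (measurableSet_openConnIn_of_countable _ _ _)).inter
      (measurableSet_openConnIn_of_countable _ _ _).compl)

/-- **Translation to the origin**: for a floor point `x` (`x 0 = 0`),
`P_s({x ↔_ℍ a} ∩ {x + e ↔_ℍ w + a} ∩ {x ↮_ℍ x + e}) = P_s({0 ↔_ℍ a - x} ∩ {e ↔_ℍ (a - x) + w} ∩ {0 ↮_ℍ e})`. -/
theorem measure_pivot_event_eq (s : unitInterval)
    (hshift : ∀ z : Site 3, z 0 = 0 → ∀ S : Set (BondConfig (Site 3)), MeasurableSet S →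
      floorDilutedPercolation 3 (criticalProbI 3) s ((BondConfig.relabel (sym2Equiv (Site.shift z))) ⁻¹' S) =
        floorDilutedPercolation 3 (criticalProbI 3) s S)
    (e w x : Site 3) (hx : x 0 = 0) (a : Site 3) :
    floorDilutedPercolation 3 (criticalProbI 3) s
        (openConnIn {x : Site 3 | 0 ≤ x 0} x a ∩ openConnIn {x : Site 3 | 0 ≤ x 0} (x + e) (w + a) ∩
          (openConnIn {x : Site 3 | 0 ≤ x 0} x (x + e))ᶜ) =
      floorDilutedPercolation 3 (criticalProbI 3) s
        (openConnIn {x : Site 3 | 0 ≤ x 0} 0 (a - x) ∩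
            openConnIn {x : Site 3 | 0 ≤ x 0} e (a - x + w) ∩
          (openConnIn {x : Site 3 | 0 ≤ x 0} 0 e)ᶜ) := by
  rw [measure_shift_event s hshift x hx 0 (a - x) e (a - x + w) 0 e, zero_add, sub_add_cancel,
    add_comm e x, show a - x + w + x = w + a by abel]

/-- **Re-indexing** `(t, x) ↦ v = a_t - x`: an injection of `ℕ × ∂ℍ` into `{v | 1 ≤ v₀}`, so the
double sum of `G (a_t - x)` is at most the sum of `G` over `{v | 1 ≤ v₀}` (in `ℝ≥0∞`). -/
theorem tsum_reindex_le (G : Site 3 → ℝ≥0∞) :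
    ∑' t : ℕ, ∑' x : {x : Site 3 // x 0 = 0}, G (Pi.single 0 ((t : ℤ) + 1) - (x : Site 3)) ≤
      ∑' v : {v : Site 3 // 1 ≤ v 0}, G v := by
  obtain ⟨f, hfinj, hfval⟩ : ∃ f : ℕ × {x : Site 3 // x 0 = 0} → {v : Site 3 // 1 ≤ v 0},
      Function.Injective f ∧
        ∀ t : ℕ, ∀ x : {x : Site 3 // x 0 = 0},
          (f (t, x) : Site 3) = Pi.single 0 ((t : ℤ) + 1) - (x : Site 3) := by
    refine ⟨fun p => ⟨Pi.single 0 ((p.1 : ℤ) + 1) - (p.2 : Site 3), ?_⟩, ?_, fun t x => rfl⟩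
    · show 1 ≤ (Pi.single (0 : Fin 3) ((p.1 : ℤ) + 1) : Site 3) 0 - (p.2 : Site 3) 0
      rw [Pi.single_eq_same, p.2.2]
      omega
    · rintro ⟨t, x⟩ ⟨t', x'⟩ h
      have h' : (Pi.single 0 ((t : ℤ) + 1) : Site 3) - (x : Site 3) =
          Pi.single 0 ((t' : ℤ) + 1) - (x' : Site 3) := congrArg Subtype.val h
      have h0 := congrFun h' 0
      simp only [Pi.sub_apply, Pi.single_eq_same, x.2, x'.2, sub_zero] at h0
      have ht : t = t' := by omega
      subst ht
      have hx : (x : Site 3) = x' := sub_right_injective h'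
      rw [Subtype.ext hx]
  calc ∑' t : ℕ, ∑' x : {x : Site 3 // x 0 = 0}, G (Pi.single 0 ((t : ℤ) + 1) - (x : Site 3))
      = ∑' t : ℕ, ∑' x : {x : Site 3 // x 0 = 0}, G (f (t, x)) :=
        tsum_congr fun t => tsum_congr fun x => by rw [hfval]
    _ = ∑' p : ℕ × {x : Site 3 // x 0 = 0}, G (f p) :=
        (ENNReal.tsum_prod' (f := fun p => G (f p))).symm
    _ ≤ ∑' v : {v : Site 3 // 1 ≤ v 0}, G v :=
        ENNReal.tsum_comp_le_tsum_of_injective hfinj fun v => G v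

end PivotTranslation

/-- **stub_pivotTranslation**: horizontal translation invariance (hypothesis `hshift`) and the
re-indexing `(t, x) ↦ v = (t+1)e₀ − x` turn the column sum of pivotal-pair probabilities into a
sum over `v ∈ ℍ₊` of `P^{ℍ}_{p_c,s}(0 ↔_ℍ v, e ↔_ℍ v + w, 0 ↮_ℍ e)`. -/
theorem stub_pivotTranslation :
    ∀ s : unitInterval, ∀ e w : Site 3, e 0 = 0 →
      (∀ z : Site 3, z 0 = 0 → ∀ S : Set (BondConfig (Site 3)), MeasurableSet S →
        floorDilutedPercolation 3 (criticalProbI 3) s ((BondConfig.relabel (sym2Equiv (Site.shift z))) ⁻¹' S) =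
          floorDilutedPercolation 3 (criticalProbI 3) s S) →
      ∑' t : ℕ, ∑' x : {x : Site 3 // x 0 = 0},
          floorDilutedPercolation 3 (criticalProbI 3) s
            (openConnIn {x : Site 3 | 0 ≤ x 0} (x : Site 3) (Pi.single 0 ((t : ℤ) + 1)) ∩ openConnIn {x : Site 3 | 0 ≤ x 0} ((x : Site 3) + e) (w + Pi.single 0 ((t : ℤ) + 1)) ∩ (openConnIn {x : Site 3 | 0 ≤ x 0} (x : Site 3) ((x : Site 3) + e))ᶜ)
        ≤ ∑' v : {v : Site 3 // 1 ≤ v 0},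
          floorDilutedPercolation 3 (criticalProbI 3) s
            (openConnIn {x : Site 3 | 0 ≤ x 0} 0 (v : Site 3) ∩ openConnIn {x : Site 3 | 0 ≤ x 0} e ((v : Site 3) + w) ∩ (openConnIn {x : Site 3 | 0 ≤ x 0} 0 e)ᶜ) := by
  intro s e w _ hshift
  refine Eq.trans_le ?_
    (PivotTranslation.tsum_reindex_le fun v : Site 3 =>
      floorDilutedPercolation 3 (criticalProbI 3) s
        (openConnIn {x : Site 3 | 0 ≤ x 0} 0 v ∩ openConnIn {x : Site 3 | 0 ≤ x 0} e (v + w) ∩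
          (openConnIn {x : Site 3 | 0 ≤ x 0} 0 e)ᶜ))
  exact tsum_congr fun t => tsum_congr fun x =>
    PivotTranslation.measure_pivot_event_eq s hshift e w x x.2 _

end Summit.CriticalPhenomena.PercolationContinuityZ3.Theorems.FloorRusso

end
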